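import Literature.NumberTheory.DiophantineGeometry.GenEllDeRamificationArch
import Literature.NumberTheory.DiophantineGeometry.GenEllDeCriticalLocus
import Mathlib.FieldTheory.IntermediateField.Adjoin.Basic
import Mathlib.FieldTheory.IntermediateField.Algebraic
import Mathlib.FieldTheory.Minpoly.Field
import Mathlib.RingTheory.Algebraic.Integral
import HarnessLib

/-!
# The critical values of `t` on the cover `D_e : r^e = x(1−x)`: algebraicity, the `Finset ℂ` of
# critical values, and a rational polynomial cutting them out ([GenEll] Thm. 2.1 (ii) ⇒ (i))

S. Mochizuki, *Arithmetic elliptic curves in general position*, Math. J. Okayama Univ. **52** (2010)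
[cite: MochizukiGenEll2010, Thm 2.1 p.12], proof of Thm. 2.1 (ii) ⇒ (i), kurims pp. 12–13: the
noncritical Belyi map `φ` on the auxiliary hyperbolic curve is built from a Belyi map `β : ℙ¹ → ℙ¹`
sending the CRITICAL VALUES of an auxiliary function to `{0, 1, ∞}`.  In the abc-iut cell's
number-field-only rendering for `(X, D) = (ℙ¹, [0]+[1]+[∞])` (GENELLTWO-P1ROUTE §2 (B), §3 (d); route
item `Summit.ABC.ABC.Theses.IUTThetaPilot.GenEllTwo`) the curve is `D_e : r^e = x(1 − x)` (`e = 2k+1`),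
`s := 1 − 2x`, the function is `t = 1/r + r^{k+1}/s = (s + r^{k+2})/(r s)`, its ramification divisor
on the affine part is cut out by `N = −s³ + (k+1)r^{k+2} − 2r^{3k+3}` (`DeArch.N` of
`GenEllDeRamificationArch.lean` = `DeCrit.Nval` of `GenEllDeCriticalLocus.lean`, see `Nval_eq_N`),
whose zero set is described by the polynomial `R = α² − β³ ∈ ℤ[X]` of `GenEllDeCriticalLocus.lean`
(`DeCrit.Rpoly`, `DeCrit.zeroSet_eq`: the zeros are the points `(critX θ, θ)`, `R(θ) = 0`), and `β` is
a Belyi map for the finite Galois-stable set `A := crit(t) ⊂ ℚ̄` (the noncritical Belyi package takes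
`A : Finset ℂ` with `∀ a ∈ A, IsAlgebraic ℚ a`).  This PROOF-AND-DEFINITIONS file supplies that input
and the inclusion "`R_t ⊆ t⁻¹(A) ⊆ t⁻¹(B)`", on top of the two landed files:

* `DeArch.t` — `t` in the coordinates `(x, r)` (`map_t`); `DeArch.tCrit k θ` — its value at the zero
  of `N` above a root `θ` of `R`, a rational function of `θ` (`t_eq_tCrit`);
* `Nval_eq_N` — the bridge `DeCrit.Nval k P = DeArch.N k P.1 P.2`;
* ALGEBRAICITY: `isIntegral_of_aeval_Rpoly` (roots of `R` are algebraic over `ℚ`),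
  `tCrit_mem_adjoin` (`tCrit k θ ∈ ℚ⟮θ⟯`), `isIntegral_tCrit`, `isIntegral_t_of_N_eq_zero`;
* `DeArch.critSet k : Finset ℂ` (the values `tCrit θ` over the complex roots of `R`; ⊇ the critical
  values of `t` on the affine curve), `mem_critSet_iff`, `t_mem_critSet_of_N_eq_zero`,
  `isAlgebraic_of_mem_critSet` (= the Belyi package's hypothesis `hA` for `A := critSet k`);
* `DeArch.critPoly k : ℚ[X]` (product of the minimal polynomials of the elements of `critSet`),
  `critPoly_ne_zero`, `aeval_t_critPoly_eq_zero` (over `ℂ`), `aeval_t_critPoly_eq_zero_of_ringHom`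
  (over any field embedding in `ℂ`: number fields, `ℚ̄`), and the set forms
  `zeros_subset_preimage_of_dvd` / `zeros_subset_preimage_of_forall` (+ `DeCrit` zero-set shape
  `zeroSet_subset_preimage_of_forall`): the zeros of `N` on `D_e(ℂ)` lie in `{P | m(t(P)) = 0}` for
  every `m ∈ ℚ[X]` divisible by `critPoly`, resp. vanishing on `critSet` (the Belyi package's output
  clause `∀ a ∈ A, aeval a (p·q·(p−q)) = 0` with `A := critSet k` has exactly this shape) — the input
  `Z ⊇ {N = 0}` of `DeArch.exists_pos_le_norm_N_of_separated_of_subset` and the hypothesis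
  "critical values ⊆ B" of the good-prime packages;
* `x`-SEPARATION forms of the archimedean lower bound of `GenEllDeRamificationArch.lean`
  (`separated_of_x_separated`, `exists_pos_le_norm_N_of_x_separated`, `sum_posLog_le_of_x_separated`):
  it suffices that the `x`-coordinates of the conjugates be `ρ`-far from the finite set
  `{critX θ | R(θ) = 0}` (⊆ `X_φ` of the menu spine), since the zeros of `N` are the points `(critX θ, θ)`.

Everything is proved; definitions `t`, `tCrit`, `critSet`, `critPoly`; no named facts.  Classical and
undisputed; nothing here refers to the disputed parts of the abc-iut corpus.  Deliberately NOT here: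
that `critSet` is EXACTLY the set of critical values (a superset suffices downstream), the local
multiplicity `ord_Q N = e_Q(t) − 1`, anything `2`-adic.
-/

noncomputable section

open Polynomial

namespace Literature.NumberTheory.DiophantineGeometry.GenEll

namespace DeArch

/-! ### The function `t`, the bridge to `DeCrit`, and `t` on the critical locus -/

section Basic

variable {F : Type*} [Field F] {k : ℕ}

/-- The function `t = 1/r + r^{k+1}/s = (s + r^{k+2})/(r·s)` on `D_e`, `s = 1 − 2x`, `e = 2k+1`
(GENELLTWO-P1ROUTE §2 (B): simple poles exactly at the three special points and the Weierstrass
points). [cite: MochizukiGenEll2010, Thm 2.1 p.12] -/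
def t (k : ℕ) (x r : F) : F := ((1 - 2 * x) + r ^ (k + 2)) / (r * (1 - 2 * x))

/-- `t` commutes with field homomorphisms. [cite: MochizukiGenEll2010, Thm 2.1 p.12] -/
theorem map_t {E : Type*} [Field E] (f : F →+* E) (k : ℕ) (x r : F) :
    f (t k x r) = t k (f x) (f r) := by
  simp [t, map_div₀, map_add, map_sub, map_mul, map_pow, map_ofNat]

/-- BRIDGE: the ramification function of `GenEllDeCriticalLocus.lean` is the ramification form of
`GenEllDeRamificationArch.lean`: `DeCrit.Nval k P = DeArch.N k P.1 P.2`.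
[cite: MochizukiGenEll2010, Thm 2.1 p.12] -/
theorem Nval_eq_N {R : Type*} [CommRing R] (k : ℕ) (P : R × R) : DeCrit.Nval k P = N k P.1 P.2 := by
  simp only [DeCrit.Nval, DeCrit.alpha, N]
  ring

/-- The value of `t` at the zero of `N` above a root `θ` of `R`: with `s_θ = α(θ)/β(θ)`
(`DeCrit.critS`), `t = (s_θ + θ^{k+2})/(θ·s_θ)` — a rational function of `θ` alone.
[cite: MochizukiGenEll2010, Thm 2.1 p.12] -/
def tCrit (k : ℕ) (θ : F) : F := (DeCrit.critS k θ + θ ^ (k + 2)) / (θ * DeCrit.critS k θ)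

/-- The `r`-coordinate of a zero of `N` on `D_e` is a root of `R` (`DeCrit.Rpoly`), in `DeArch`
vocabulary. [cite: MochizukiGenEll2010, Thm 2.1 p.12] -/
theorem aeval_Rpoly_of_N_eq_zero {P : F × F} (hP : P ∈ curve F k) (hN : N k P.1 P.2 = 0) :
    aeval P.2 (DeCrit.Rpoly k) = 0 :=
  DeCrit.aeval_Rpoly_eq_zero_of_Nval_eq_zero k (mem_curve_iff.mp hP) (by rw [Nval_eq_N]; exact hN)

variable [CharZero F]

/-- `e = 2k + 1 ≠ 0` in a field of characteristic zero (the standing hypothesis of the `DeCrit`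
lemmas). [cite: MochizukiGenEll2010, Thm 2.1 p.12] -/
theorem cast_two_mul_add_one_ne_zero (k : ℕ) : ((2 * k + 1 : ℕ) : F) ≠ 0 :=
  Nat.cast_ne_zero.mpr (by omega)

/-- On a zero of `N` on `D_e`: `1 − 2x = s_r` (`DeCrit.critS`). [cite: MochizukiGenEll2010, Thm 2.1 p.12] -/
theorem one_sub_two_mul_eq_critS {P : F × F} (hP : P ∈ curve F k) (hN : N k P.1 P.2 = 0) :
    1 - 2 * P.1 = DeCrit.critS k P.2 := by
  have hx := DeCrit.fst_eq_critX_of_Nval_eq_zero k (two_ne_zero : (2 : F) ≠ 0)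
    (cast_two_mul_add_one_ne_zero k) (mem_curve_iff.mp hP) (by rw [Nval_eq_N]; exact hN)
  rw [hx, DeCrit.one_sub_two_mul_critX k (two_ne_zero : (2 : F) ≠ 0)]

/-- NON-DEGENERACY: a zero of `N` on `D_e` has `r ≠ 0` and `s = 1 − 2x ≠ 0` — it is not a pole of
`t`. [cite: MochizukiGenEll2010, Thm 2.1 p.12] -/
theorem snd_ne_zero_and_one_sub_two_mul_ne_zero {P : F × F} (hP : P ∈ curve F k)
    (hN : N k P.1 P.2 = 0) : P.2 ≠ 0 ∧ 1 - 2 * P.1 ≠ 0 := by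
  have hR := aeval_Rpoly_of_N_eq_zero hP hN
  refine ⟨DeCrit.root_ne_zero k hR, ?_⟩
  rw [one_sub_two_mul_eq_critS hP hN, DeCrit.critS]
  exact div_ne_zero (DeCrit.alpha_ne_zero_of_root k (cast_two_mul_add_one_ne_zero k) hR)
    (DeCrit.beta_ne_zero_of_root k (cast_two_mul_add_one_ne_zero k) hR)

/-- On a zero of `N` on `D_e`, `t(P) = tCrit k r`. [cite: MochizukiGenEll2010, Thm 2.1 p.12] -/
theorem t_eq_tCrit {P : F × F} (hP : P ∈ curve F k) (hN : N k P.1 P.2 = 0) :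
    t k P.1 P.2 = tCrit k P.2 := by
  unfold t tCrit
  rw [one_sub_two_mul_eq_critS hP hN]

end Basic

/-! ### Algebraicity -/

section Algebraic

open IntermediateField

variable {F : Type*} [Field F] [CharZero F] {k : ℕ}

/-- A root of `R ∈ ℤ[X]` is integral over `ℚ` (`R ≠ 0`). [cite: MochizukiGenEll2010, Thm 2.1 p.12] -/
theorem isIntegral_of_aeval_Rpoly {θ : F} (hθ : aeval θ (DeCrit.Rpoly k) = 0) : IsIntegral ℚ θ := by
  have hne : (DeCrit.Rpoly k).map (algebraMap ℤ ℚ) ≠ 0 :=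
    (Polynomial.map_ne_zero_iff (algebraMap ℤ ℚ).injective_int).mpr (DeCrit.Rpoly_ne_zero k)
  have hev : aeval θ ((DeCrit.Rpoly k).map (algebraMap ℤ ℚ)) = 0 := by
    rw [aeval_map_algebraMap]; exact hθ
  exact (show IsAlgebraic ℚ θ from ⟨_, hne, hev⟩).isIntegral

/-- `tCrit k θ ∈ ℚ⟮θ⟯`. [cite: MochizukiGenEll2010, Thm 2.1 p.12] -/
theorem tCrit_mem_adjoin (k : ℕ) (θ : F) : tCrit k θ ∈ ℚ⟮θ⟯ := by
  have hθ : θ ∈ ℚ⟮θ⟯ := mem_adjoin_simple_self ℚ θ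
  have hs : DeCrit.critS k θ ∈ ℚ⟮θ⟯ := by
    unfold DeCrit.critS DeCrit.alpha DeCrit.beta
    exact div_mem
      (sub_mem (mul_mem (add_mem (IntermediateField.natCast_mem _ k) (one_mem _)) (pow_mem hθ _))
        (mul_mem (ofNat_mem _ 2) (pow_mem hθ _)))
      (sub_mem (one_mem _) (mul_mem (ofNat_mem _ 4) (pow_mem hθ _)))
  unfold tCrit
  exact div_mem (add_mem hs (pow_mem hθ _)) (mul_mem hθ hs)

/-- For a root `θ` of `R`, `tCrit k θ` is integral over `ℚ` (it lies in the finite extension `ℚ⟮θ⟯`).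
[cite: MochizukiGenEll2010, Thm 2.1 p.12] -/
theorem isIntegral_tCrit {θ : F} (hθ : aeval θ (DeCrit.Rpoly k) = 0) : IsIntegral ℚ (tCrit k θ) := by
  haveI : FiniteDimensional ℚ ℚ⟮θ⟯ := adjoin.finiteDimensional (isIntegral_of_aeval_Rpoly hθ)
  have h : IsIntegral ℚ (⟨tCrit k θ, tCrit_mem_adjoin k θ⟩ : ℚ⟮θ⟯) := IsIntegral.of_finite ℚ _
  exact isIntegral_iff.mp h

/-- ALGEBRAICITY: the value `t(P)` at a zero of `N` on `D_e(F)` is integral (algebraic) over `ℚ`.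
[cite: MochizukiGenEll2010, Thm 2.1 p.12] -/
theorem isIntegral_t_of_N_eq_zero {P : F × F} (hP : P ∈ curve F k) (hN : N k P.1 P.2 = 0) :
    IsIntegral ℚ (t k P.1 P.2) := by
  rw [t_eq_tCrit hP hN]
  exact isIntegral_tCrit (aeval_Rpoly_of_N_eq_zero hP hN)

end Algebraic

/-! ### The critical-value set and polynomial -/

section Crit

variable {k : ℕ}

/-- THE CRITICAL-VALUE SET of `t` on `D_e` (⊇ `t`(affine ramification points), which are the zeros of
`N`): the values `tCrit θ` over the complex roots `θ` of `R`, a `Finset ℂ`.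
[cite: MochizukiGenEll2010, Thm 2.1 p.12] -/
def critSet (k : ℕ) : Finset ℂ := ((DeCrit.Rpoly k).aroots ℂ).toFinset.image (tCrit k)

/-- Membership in `critSet`. [cite: MochizukiGenEll2010, Thm 2.1 p.12] -/
theorem mem_critSet_iff {a : ℂ} :
    a ∈ critSet k ↔ ∃ θ : ℂ, aeval θ (DeCrit.Rpoly k) = 0 ∧ tCrit k θ = a := by
  constructor
  · intro ha
    obtain ⟨θ, hθ, hθa⟩ := Finset.mem_image.mp ha
    exact ⟨θ, (mem_aroots'.mp (Multiset.mem_toFinset.mp hθ)).2, hθa⟩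
  · rintro ⟨θ, hθ, hθa⟩
    exact Finset.mem_image.mpr
      ⟨θ, Multiset.mem_toFinset.mpr (mem_aroots'.mpr ⟨DeCrit.Rpoly_map_ne_zero k, hθ⟩), hθa⟩

/-- Every zero of `N` on `D_e(ℂ)` has its `t`-value in `critSet` ("`R_t ⊆ t⁻¹(A)`").
[cite: MochizukiGenEll2010, Thm 2.1 p.12] -/
theorem t_mem_critSet_of_N_eq_zero {P : ℂ × ℂ} (hP : P ∈ curve ℂ k) (hN : N k P.1 P.2 = 0) :
    t k P.1 P.2 ∈ critSet k :=
  mem_critSet_iff.mpr ⟨P.2, aeval_Rpoly_of_N_eq_zero hP hN, (t_eq_tCrit hP hN).symm⟩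

/-- Every element of `critSet` is integral over `ℚ`. [cite: MochizukiGenEll2010, Thm 2.1 p.12] -/
theorem isIntegral_of_mem_critSet {a : ℂ} (ha : a ∈ critSet k) : IsIntegral ℚ a := by
  obtain ⟨θ, hθ, rfl⟩ := mem_critSet_iff.mp ha
  exact isIntegral_tCrit hθ

/-- Every element of `critSet` is algebraic over `ℚ` — the hypothesis `hA` of the noncritical Belyi
map package (`∀ a ∈ A, IsAlgebraic ℚ a`, with `A := critSet k`). [cite: MochizukiGenEll2010, Thm 2.1 p.12] -/
theorem isAlgebraic_of_mem_critSet {a : ℂ} (ha : a ∈ critSet k) : IsAlgebraic ℚ a :=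
  (isIntegral_of_mem_critSet ha).isAlgebraic

/-- THE CRITICAL-VALUE POLYNOMIAL: a nonzero rational polynomial vanishing on `critSet` (product of
minimal polynomials). [cite: MochizukiGenEll2010, Thm 2.1 p.12] -/
def critPoly (k : ℕ) : ℚ[X] := ∏ a ∈ critSet k, minpoly ℚ a

/-- `critPoly ≠ 0`. [cite: MochizukiGenEll2010, Thm 2.1 p.12] -/
theorem critPoly_ne_zero (k : ℕ) : critPoly k ≠ 0 :=
  Finset.prod_ne_zero_iff.mpr fun _ ha => minpoly.ne_zero (isIntegral_of_mem_critSet ha)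

/-- `critPoly` vanishes on `critSet`. [cite: MochizukiGenEll2010, Thm 2.1 p.12] -/
theorem aeval_critPoly_of_mem_critSet {a : ℂ} (ha : a ∈ critSet k) : aeval a (critPoly k) = 0 := by
  rw [critPoly, map_prod]
  exact Finset.prod_eq_zero ha (minpoly.aeval ℚ a)

/-- **CRITICAL VALUES ARE ROOTS OF `critPoly`** (over `ℂ`): for every zero `P` of `N` on `D_e(ℂ)`,
`critPoly(t(P)) = 0`. [cite: MochizukiGenEll2010, Thm 2.1 p.12] -/
theorem aeval_t_critPoly_eq_zero {P : ℂ × ℂ} (hP : P ∈ curve ℂ k) (hN : N k P.1 P.2 = 0) :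
    aeval (t k P.1 P.2) (critPoly k) = 0 :=
  aeval_critPoly_of_mem_critSet (t_mem_critSet_of_N_eq_zero hP hN)

/-- Transported form: for any field `F` with a homomorphism `ι : F →+* ℂ` (number fields, `ℚ̄`), every
zero `P` of `N` on `D_e(F)` has `critPoly(t(P)) = 0`. [cite: MochizukiGenEll2010, Thm 2.1 p.12] -/
theorem aeval_t_critPoly_eq_zero_of_ringHom {F : Type*} [Field F] [CharZero F] (ι : F →+* ℂ)
    {P : F × F} (hP : P ∈ curve F k) (hN : N k P.1 P.2 = 0) :
    aeval (t k P.1 P.2) (critPoly k) = 0 := by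
  have hP' : ((ι P.1, ι P.2) : ℂ × ℂ) ∈ curve ℂ k := map_mem_curve ι hP
  have hN' : N k (ι P.1) (ι P.2) = 0 := by rw [← map_N, hN, map_zero]
  have h := aeval_t_critPoly_eq_zero hP' hN'
  have hcomm : (algebraMap ℚ ℂ).comp (RingHom.id ℚ) = ι.comp (algebraMap ℚ F) :=
    Subsingleton.elim _ _
  have key := Polynomial.map_aeval_eq_aeval_map hcomm (critPoly k) (t k P.1 P.2)
  rw [Polynomial.map_id, map_t] at key
  rw [← key, map_eq_zero_iff ι ι.injective] at h
  exact h

/-- SET FORM ("`R_t ⊆ E_φ = t⁻¹(B)`"): for every rational polynomial `m` divisible by `critPoly`, the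
zeros of `N` on `D_e(ℂ)` lie in `{P | m(t(P)) = 0}` — the input `Z ⊇ {N = 0}` of
`exists_pos_le_norm_N_of_separated_of_subset`. [cite: MochizukiGenEll2010, Thm 2.1 p.12] -/
theorem zeros_subset_preimage_of_dvd {m : ℚ[X]} (hm : critPoly k ∣ m) :
    {P : ℂ × ℂ | P ∈ curve ℂ k ∧ N k P.1 P.2 = 0} ⊆ {P | aeval (t k P.1 P.2) m = 0} := by
  rintro P ⟨hP, hN⟩
  obtain ⟨q, rfl⟩ := hm
  simp only [Set.mem_setOf_eq, map_mul, aeval_t_critPoly_eq_zero hP hN, zero_mul]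

/-- SET FORM with a vanishing hypothesis instead of divisibility: if `m(a) = 0` for all `a ∈ critSet k`
(the shape of the Belyi package's output `∀ a ∈ A, aeval a (p·q·(p−q)) = 0` with `A := critSet k`),
then the zeros of `N` on `D_e(ℂ)` lie in `{P | m(t(P)) = 0}`. [cite: MochizukiGenEll2010, Thm 2.1 p.12] -/
theorem zeros_subset_preimage_of_forall {m : ℚ[X]} (hm : ∀ a ∈ critSet k, aeval a m = 0) :
    {P : ℂ × ℂ | P ∈ curve ℂ k ∧ N k P.1 P.2 = 0} ⊆ {P | aeval (t k P.1 P.2) m = 0} :=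
  fun _ hP => hm _ (t_mem_critSet_of_N_eq_zero hP.1 hP.2)

/-- The same inclusion in the zero-set shape of `GenEllDeCriticalLocus.lean`
(`{z | z.2^{2k+1} = z.1(1 − z.1) ∧ DeCrit.Nval k z = 0}`, cf. `DeCrit.zeroSet_eq`).
[cite: MochizukiGenEll2010, Thm 2.1 p.12] -/
theorem zeroSet_subset_preimage_of_forall {m : ℚ[X]} (hm : ∀ a ∈ critSet k, aeval a m = 0) :
    {z : ℂ × ℂ | z.2 ^ (2 * k + 1) = z.1 * (1 - z.1) ∧ DeCrit.Nval k z = 0} ⊆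
      {z | aeval (t k z.1 z.2) m = 0} :=
  fun z hz => hm _ (t_mem_critSet_of_N_eq_zero (mem_curve_iff.mpr hz.1) (by rw [← Nval_eq_N]; exact hz.2))

/-- The critical points `Q_θ = (critX θ, θ)` of `GenEllDeCriticalLocus.lean` have `t`-value `tCrit θ`,
which lies in `critSet` (over `ℂ`). [cite: MochizukiGenEll2010, Thm 2.1 p.12] -/
theorem t_critPoint_mem_critSet {θ : ℂ} (hθ : aeval θ (DeCrit.Rpoly k) = 0) :
    t k (DeCrit.critPoint k θ).1 (DeCrit.critPoint k θ).2 ∈ critSet k := by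
  have hmem : (DeCrit.critPoint k θ : ℂ × ℂ) ∈ curve ℂ k :=
    mem_curve_iff.mpr (DeCrit.critPoint_mem k two_ne_zero (cast_two_mul_add_one_ne_zero k) hθ)
  have hN : N k (DeCrit.critPoint k θ).1 (DeCrit.critPoint k θ).2 = 0 := by
    rw [← Nval_eq_N]; exact DeCrit.Nval_critPoint k two_ne_zero (cast_two_mul_add_one_ne_zero k) hθ
  exact t_mem_critSet_of_N_eq_zero hmem hN

end Crit

/-! ### Separation in the `x`-coordinate only (the shape of the menu spine's hypothesis) -/

section XSeparation

open Real

variable {k : ℕ}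

/-- The zeros of `N` on `D_e(ℂ)` are the critical points `(critX θ, θ)`: a point whose `x`-coordinate
is `ρ`-far from every `critX θ` (`R(θ) = 0`) is `ρ`-far (sup-distance) from every zero of `N`.
[cite: MochizukiGenEll2010, Thm 2.1 p.12] -/
theorem separated_of_x_separated {ρ : ℝ} {P : ℂ × ℂ}
    (hsep : ∀ θ : ℂ, aeval θ (DeCrit.Rpoly k) = 0 → ρ ≤ ‖P.1 - DeCrit.critX k θ‖) :
    ∀ Q ∈ curve ℂ k, N k Q.1 Q.2 = 0 → ρ ≤ dist P Q := by
  intro Q hQ hN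
  have hR := aeval_Rpoly_of_N_eq_zero hQ hN
  have hx : Q.1 = DeCrit.critX k Q.2 :=
    DeCrit.fst_eq_critX_of_Nval_eq_zero k two_ne_zero (cast_two_mul_add_one_ne_zero k)
      (mem_curve_iff.mp hQ) (by rw [Nval_eq_N]; exact hN)
  calc ρ ≤ ‖P.1 - DeCrit.critX k Q.2‖ := hsep Q.2 hR
    _ = dist P.1 Q.1 := by rw [hx, dist_eq_norm]
    _ ≤ dist P Q := by rw [Prod.dist_eq]; exact le_max_left _ _

/-- LOWER BOUND UNDER `x`-SEPARATION: for every `ρ > 0` there is `c > 0` (the constant of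
`exists_pos_le_norm_N_of_separated`) such that every `P ∈ D_e(ℂ)` whose `x`-coordinate is `ρ`-far
from all `critX θ`, `R(θ) = 0` — a fortiori from the finite set `X_φ ⊇ x(R_t)` of the menu spine —
has `‖N(P)‖ ≥ c`. [cite: MochizukiGenEll2010, Thm 2.1 p.12] -/
theorem exists_pos_le_norm_N_of_x_separated (k : ℕ) {ρ : ℝ} (hρ : 0 < ρ) :
    ∃ c : ℝ, 0 < c ∧ ∀ P ∈ curve ℂ k,
      (∀ θ : ℂ, aeval θ (DeCrit.Rpoly k) = 0 → ρ ≤ ‖P.1 - DeCrit.critX k θ‖) → c ≤ ‖N k P.1 P.2‖ := by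
  obtain ⟨c, hc, h⟩ := exists_pos_le_norm_N_of_separated k hρ
  exact ⟨c, hc, fun P hP hsep => h P hP (separated_of_x_separated hsep)⟩

/-- NUMBER-FIELD FORM UNDER `x`-SEPARATION OF THE CONJUGATES (the shape "all conjugates of `Q.x`
`r`-far from `X_φ` at `∞`" of the menu spine, with `X_φ ⊇ {critX θ}`): with the constant `c` of
`exists_pos_le_norm_N_of_separated`,
`Σ_{σ : K →+* ℂ} log⁺ ‖σ(N(x,r))‖⁻¹ ≤ [K:ℚ]·log⁺ c⁻¹`. [cite: MochizukiGenEll2010, Thm 2.1 p.12] -/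
theorem sum_posLog_le_of_x_separated {K : Type*} [Field K] [NumberField K] {x r : K}
    (hxr : r ^ (2 * k + 1) = x * (1 - x)) {ρ c : ℝ} (hc : 0 < c)
    (h : ∀ P ∈ curve ℂ k, (∀ Q ∈ curve ℂ k, N k Q.1 Q.2 = 0 → ρ ≤ dist P Q) →
      c ≤ ‖N k P.1 P.2‖)
    (hsep : ∀ σ : K →+* ℂ, ∀ θ : ℂ, aeval θ (DeCrit.Rpoly k) = 0 → ρ ≤ ‖σ x - DeCrit.critX k θ‖) :
    ∑ σ : K →+* ℂ, log⁺ ‖σ (N k x r)‖⁻¹ ≤ Module.finrank ℚ K * log⁺ c⁻¹ :=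
  sum_posLog_le hxr hc h fun σ => separated_of_x_separated (P := (σ x, σ r)) (hsep σ)

end XSeparation

end DeArch

end Literature.NumberTheory.DiophantineGeometry.GenEll
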